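import Summits.Ventures.HodgeRepro2.T5SiegelLevi

/-!
# From the printed Levi value `c(χ)(m(a)) = χ(det a)` to `c(χ) = ν_χ ∘ det`

Kernel support (seat p3, cell pub-hodge-repro2) behind §F.1 of `route/T5-route-3.md` (the
normalisation of `c_v(χ_v)`). The sentence there reads: «On the Siegel Levi `m(a) ∈ M_Y ≅ GL(Y)`
of a SPLIT `W` one has `x(m(a)) = det a ∈ E^×` and `det m(a) = det a / \overline{det a}`; since
`χ|_{F^×} = 1`, `χ` factors through `E^×/F^× ≅ E¹` (`x ↦ x/x̄`, Hilbert 90) — write `ν_χ` for the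
character of `E¹` with `ν_χ(x/x̄) = χ(x)` — so `χ(x(m(a))) = ν_χ(det m(a))`. A character of `U(W)`
… is `ν′∘det` for a character `ν′` of `E¹`, and `det(M_Y) = E¹` (Hilbert 90) forces `ν′ = ν_χ`:
hence `c(χ) = ν_χ∘det` on `U(W)`».

The ONLY printed input is the value of the splitting character on the Levi, HKS96 (1.15) /
Lemma 1.3 as printed: `c(χ)(m(a)) = χ(x(m(a))) = χ(det a)`. This file records the deduction from
that input in the model `U(ℍ) = hypUnitary E` of files 23 / 74 / 75 / 81, for `n = 2` (`GL(Y) = Eˣ`,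
`x(m(t)) = t`):

* `factor_apply_diagHom`: for the Hilbert-90 factor `ν_χ` of a character `χ` of `Eˣ` trivial on
  the `star`-fixed elements (file 31), `χ(t) = ν_χ(det m(t))` — «`χ(x(m(a))) = ν_χ(det m(a))`»;
* `eq_factor_comp_det` (THE DEDUCTION): a character `c` of `U(ℍ)` whose Levi values are
  `c(m(t)) = χ(t)` equals `ν_χ ∘ det` — by file 81's forcing (a character of `U(ℍ)` is determined
  by its Levi restriction) — and `ν_χ` is unique (`factor_unique_of_levi`);
* `exists_unique_factor_of_levi`: the packaged form — there is exactly one character `ν` of `E¹`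
  with `c = ν ∘ det`, and it is the Hilbert-90 factor of `χ`.

What stays prose: the printed input itself (that HKS's `c(χ)`, `x(g)` and `M_Y` are the model's
objects and that `c(χ)(m(a)) = χ(det a)` as printed). Header declaration (README §8(d)): uses an
L-value-free non-vanishing device: no.
-/

namespace Summit.Ventures.HodgeRepro2.T5SplittingCharacterForcing

open T5UnipotentCommutator T5HyperbolicDet T5HyperbolicCharacters T5SiegelLevi
  T5NormOneCharacters ShimuraData.B3Characters

variable {E : Type*} [Field E] [StarRing E] {M : Type*} [CommGroup M]

/-- The standing hypothesis «`χ|_{F^×} = 1`»: `χ` is trivial on the `star`-fixed units. -/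
def TrivialOnFixed (χ : Eˣ →* M) : Prop :=
  ∀ a : Eˣ, star (a : E) = a → χ a = 1

/-- «`χ(x(m(a))) = ν_χ(det m(a))`»: for a Hilbert-90 factor `ν` of `χ` (`χ(a) = ν(a/ā)`, file 31),
the value of `χ` at `t` is the value of `ν` at `det m(t) = t/t̄`. -/
theorem factor_apply_diagHom (χ : Eˣ →* M) (ν : normOne (unitsConj (starRingAut (R := E))) →* M)
    (hν : ∀ a : Eˣ, χ a = ν (jHomNormOne starRingAut starRingAut_involutive a)) (t : Eˣ) :
    χ t = ν (detNormOne (diagHom t)) := by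
  rw [hν t, detNormOne_diagHom]

/-- A Hilbert-90 factor exists for every `χ` trivial on the `star`-fixed units (file 31, read
through `starRingAut`). -/
theorem exists_factor (ha : ∃ a : E, star a ≠ a) (χ : Eˣ →* M) (hχ : TrivialOnFixed χ) :
    ∃ ν : normOne (unitsConj (starRingAut (R := E))) →* M,
      ∀ a : Eˣ, χ a = ν (jHomNormOne starRingAut starRingAut_involutive a) :=
  exists_factor_normOne starRingAut starRingAut_involutive ha χ hχ

/-- THE DEDUCTION «hence `c(χ) = ν_χ∘det` on `U(W)`»: if the Levi values of a character `c` of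
`U(ℍ)` are `c(m(t)) = χ(t)` (the printed HKS Lemma 1.3 / (1.15), `x(m(t)) = t`) and `ν` is a
Hilbert-90 factor of `χ`, then `c = ν ∘ det`. -/
theorem eq_factor_comp_det (ha : ∃ a : E, star a ≠ a) (ht : ∃ t : E, t ≠ 0 ∧ t * star t ≠ 1)
    (c : hypUnitary E →* M) (χ : Eˣ →* M)
    (ν : normOne (unitsConj (starRingAut (R := E))) →* M)
    (hν : ∀ a : Eˣ, χ a = ν (jHomNormOne starRingAut starRingAut_involutive a))
    (hc : ∀ t : Eˣ, c (diagHom t) = χ t) : c = ν.comp detNormOne := by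
  apply eq_comp_detNormOne_of_diagHom ha ht c ν
  intro t
  rw [hc t, hν t]

/-- The factor is unique: two characters `ν₁`, `ν₂` of `E¹` with `c = ν₁ ∘ det = ν₂ ∘ det` agree. -/
theorem factor_unique_of_levi (ha : ∃ a : E, star a ≠ a)
    (ν₁ ν₂ : normOne (unitsConj (starRingAut (R := E))) →* M)
    (h : ν₁.comp detNormOne = ν₂.comp detNormOne) : ν₁ = ν₂ := by
  apply factor_det_unique ha
  intro g
  exact congrArg (fun f => f g) h

/-- The packaged statement: for `χ` trivial on the `star`-fixed units and a character `c` of `U(ℍ)`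
with `c(m(t)) = χ(t)`, there is exactly one character `ν` of `E¹` with `c = ν ∘ det`, and it is the
Hilbert-90 factor of `χ`: `χ(a) = ν(a/ā)`. -/
theorem exists_unique_factor_of_levi (ha : ∃ a : E, star a ≠ a)
    (ht : ∃ t : E, t ≠ 0 ∧ t * star t ≠ 1) (c : hypUnitary E →* M) (χ : Eˣ →* M)
    (hχ : TrivialOnFixed χ) (hc : ∀ t : Eˣ, c (diagHom t) = χ t) :
    ∃! ν : normOne (unitsConj (starRingAut (R := E))) →* M,
      (∀ a : Eˣ, χ a = ν (jHomNormOne starRingAut starRingAut_involutive a)) ∧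
        c = ν.comp detNormOne := by
  obtain ⟨ν, hν⟩ := exists_factor ha χ hχ
  refine ⟨ν, ⟨hν, eq_factor_comp_det ha ht c χ ν hν hc⟩, ?_⟩
  rintro ν' ⟨-, hν'⟩
  exact factor_unique_of_levi ha ν' ν (hν'.symm.trans (eq_factor_comp_det ha ht c χ ν hν hc))

/-- Conversely, the Levi values of `ν ∘ det` are `χ`: the printed input is also NECESSARY for the
conclusion. -/
theorem levi_values_of_factor (χ : Eˣ →* M)
    (ν : normOne (unitsConj (starRingAut (R := E))) →* M)
    (hν : ∀ a : Eˣ, χ a = ν (jHomNormOne starRingAut starRingAut_involutive a)) (t : Eˣ) :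
    (ν.comp detNormOne) (diagHom t) = χ t := by
  rw [MonoidHom.comp_apply, ← factor_apply_diagHom χ ν hν t]

/-- The Levi values of a character of `U(ℍ)` are trivial on the `star`-fixed units (file 74's
`map_diagU_of_star_eq`): the standing hypothesis `χ|_{F^×} = 1` is forced on any `χ` that arises
as Levi values. -/
theorem trivialOnFixed_of_levi (ha : ∃ a : E, star a ≠ a) (ht : ∃ t : E, t ≠ 0 ∧ t * star t ≠ 1)
    (c : hypUnitary E →* M) (χ : Eˣ →* M) (hc : ∀ t : Eˣ, c (diagHom t) = χ t) :
    TrivialOnFixed χ := by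
  intro a has
  rw [← hc a, diagHom_apply]
  exact map_diagU_of_star_eq c ha ht (a : E) a.ne_zero has

end Summit.Ventures.HodgeRepro2.T5SplittingCharacterForcing
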